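import Literature.AlgebraicGeometry.ModuliOfAbelianVarieties.SymplecticSimilitudeCoprimeInverse
import HarnessLib

/-!
# The multiplier of an integral Hecke datum congruent to `1 mod N` is prime to `N`
# ([ShimuraIATAF1971] §3.2–3.3; [Deligne1971TravauxShimura] 4.11–4.12)

[ShimuraIATAF1971, §3.2 («det β = b»)] / [Deligne1971TravauxShimura, 4.11–4.12 (pp. 148–149)]: for an integral symplectic
similitude datum `γ, γ⋆ ∈ M_{2g}(ℤ)` with `γγ⋆ = ν` and `ᵗγ⋆ E_δ γ⋆ = ν E_δ` one has `det γ = det γ⋆ = ± ν^g`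
(`(det γ⋆)² = ν^{2g}` by taking determinants, `det γ · det γ⋆ = ν^{2g}`); if moreover `γ ≡ 1 (mod N)` then
`det γ ≡ 1 (mod N)`, so `ν^{2g} ≡ 1 (mod N)` and **`ν` is prime to `N`** (`g ≥ 1`).  This is the coprimality
`(ν, N) = 1` the level-`N` structure of the Hecke isogeny quotient needs (★ `LevelStructureOfIsogeny`, ★
`LevelStructureOfHeckeQuotient`): it is AUTOMATIC from the datum `(γ, γ⋆, ν, N)` of the link ((QA4) `γ ≡ 1 (mod N)`).
* `det_typeForm_ne_zero` — `det E_δ ≠ 0` for `δᵢ ≠ 0` (★ `typeForm_mul_adjugateBlocks`);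
* `det_sq_eq_pow_of_similitude` — `(det γ⋆)² = ν^{2g}`;
* `coprime_of_heckeDatum` — the statement.
Theorems only; cell hodgecm-mathlib, seat B-p04 (g17), (O-y) §2 (discharges the `hcop` binder of ★
`LevelStructure.exists_level_symplectic_of_heckeQuotient`).  HC_CM is proved only modulo the 7 printed citations until rung 0 closes.

## References
* [ShimuraIATAF1971] G. Shimura, *Introduction to the Arithmetic Theory of Automorphic Functions* (1971), §3.2–§3.3.
* [Deligne1971TravauxShimura] P. Deligne, *Travaux de Shimura* (1971), 4.11–4.12 (pp. 148–149).
* [GenestierNgo2020] A. Genestier, B. C. Ngô, *Lectures on Shimura varieties*, §1.2.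
-/

noncomputable section

open Matrix

namespace Literature.AlgebraicGeometry.ModuliOfAbelianVarieties

variable {g : ℕ} {δ : Fin g → ℕ}

/-- **`det E_δ ≠ 0`** when every `δᵢ ≠ 0` (from `E_δ · E′ = (∏ δᵢ) · 1`, ★ `typeForm_mul_adjugateBlocks`).
[cite: GenestierNgo2020, §1.2 (symplectic basis of type D)] -/
theorem det_typeForm_ne_zero (hδ : ∀ i, δ i ≠ 0) : (typeForm δ).det ≠ 0 := by
  have h := congrArg Matrix.det (typeForm_mul_adjugateBlocks δ)
  rw [Matrix.det_mul, Matrix.det_smul, Matrix.det_one, mul_one] at h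
  have hP : ((∏ j, δ j : ℕ) : ℤ) ≠ 0 := by
    exact_mod_cast Finset.prod_ne_zero_iff.mpr fun j _ => hδ j
  intro h0
  rw [h0, zero_mul] at h
  exact pow_ne_zero _ hP h.symm

/-- **`(det γ⋆)² = ν^{2g}`** for an integral `E_δ`-similitude `ᵗγ⋆ E_δ γ⋆ = ν E_δ` (`δᵢ ≠ 0`).
[cite: ShimuraIATAF1971, §3.2 («det β = b»)] -/
theorem det_sq_eq_pow_of_similitude (hδ : ∀ i, δ i ≠ 0) {ν : ℤ} (γs : Matrix (Fin g ⊕ Fin g) (Fin g ⊕ Fin g) ℤ)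
    (hsim : γsᵀ * typeForm δ * γs = ν • typeForm δ) :
    γs.det ^ 2 = ν ^ (g + g) := by
  have h := congrArg Matrix.det hsim
  rw [Matrix.det_mul, Matrix.det_mul, Matrix.det_transpose, Matrix.det_smul, Fintype.card_sum, Fintype.card_fin,
    mul_comm γs.det (typeForm δ).det, mul_assoc, mul_comm ((typeForm δ).det)] at h
  rw [sq]
  exact mul_right_cancel₀ (det_typeForm_ne_zero hδ) h

/-- **The multiplier of an integral Hecke datum `≡ 1 (mod N)` is prime to `N`**: `γγ⋆ = ν·1`, `ᵗγ⋆E_δγ⋆ = νE_δ`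
(`δᵢ ≠ 0`), `γ ≡ 1 (mod N)` entrywise, `g ≥ 1`, `ν ≠ 0` ⟹ `(ν, N) = 1`.  (`det γ · det γ⋆ = ν^{2g} = (det γ⋆)²` gives
`det γ = det γ⋆`, so `ν^{2g} = (det γ)² ≡ 1 (mod N)`.) [cite: ShimuraIATAF1971, §3.2 («det β = b»)]
[cite: Deligne1971TravauxShimura, 4.11–4.12 pp. 148–149] -/
theorem coprime_of_heckeDatum (hg : 0 < g) (hδ : ∀ i, δ i ≠ 0) {N ν : ℕ} (hν : ν ≠ 0)
    (γm γs : Matrix (Fin g ⊕ Fin g) (Fin g ⊕ Fin g) ℤ) (hγ : γm * γs = (ν : ℤ) • (1 : Matrix _ _ ℤ))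
    (hsim : γsᵀ * typeForm δ * γs = (ν : ℤ) • typeForm δ) (hQA4 : ∀ k i, (N : ℤ) ∣ (γm - 1) k i) :
    Nat.Coprime ν N := by
  -- determinants
  have hb2 : γs.det ^ 2 = (ν : ℤ) ^ (g + g) := det_sq_eq_pow_of_similitude hδ γs hsim
  have hab : γm.det * γs.det = (ν : ℤ) ^ (g + g) := by
    have h := congrArg Matrix.det hγ
    rwa [Matrix.det_mul, Matrix.det_smul, Matrix.det_one, mul_one, Fintype.card_sum, Fintype.card_fin] at h
  have hb0 : γs.det ≠ 0 := by
    intro h0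
    rw [h0, sq, zero_mul] at hb2
    exact pow_ne_zero _ (by exact_mod_cast hν : (ν : ℤ) ≠ 0) hb2.symm
  have hab' : γm.det = γs.det := by
    rw [← hb2, sq] at hab
    exact mul_right_cancel₀ hb0 hab
  have ha2 : γm.det ^ 2 = (ν : ℤ) ^ (g + g) := by rw [hab', hb2]
  -- `det γ ≡ 1 (mod N)`
  have hmap : γm.map (Int.castRingHom (ZMod N)) = 1 := by
    ext k i
    have hki : ((γm k i : ℤ) : ZMod N) = (((1 : Matrix (Fin g ⊕ Fin g) (Fin g ⊕ Fin g) ℤ) k i : ℤ) : ZMod N) := by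
      rw [← sub_eq_zero, ← Int.cast_sub]
      exact (ZMod.intCast_zmod_eq_zero_iff_dvd _ N).2 (hQA4 k i)
    rw [Matrix.map_apply, eq_intCast, hki, Matrix.one_apply, Matrix.one_apply]
    split_ifs <;> simp
  have hdet1 : ((γm.det : ℤ) : ZMod N) = 1 := by
    have h := RingHom.map_det (Int.castRingHom (ZMod N)) γm
    rw [RingHom.mapMatrix_apply, hmap, Matrix.det_one, eq_intCast] at h
    exact h
  -- `ν^{2g} ≡ 1 (mod N)` ⟹ `ν` a unit mod `N`
  have hν2g : ((ν : ZMod N)) ^ (g + g) = 1 := by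
    have h := congrArg (fun z : ℤ => (z : ZMod N)) ha2
    simp only [Int.cast_pow, Int.cast_natCast, hdet1, one_pow] at h
    exact h.symm
  have hunit : IsUnit ((ν : ZMod N)) :=
    (isUnit_pow_iff (Nat.add_pos_left hg g).ne').1 (hν2g ▸ isUnit_one)
  exact (ZMod.isUnit_iff_coprime ν N).1 hunit

end Literature.AlgebraicGeometry.ModuliOfAbelianVarieties

end
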